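import Literature.Barriers.FinalStateConjecture.ExtremalHorizonCarterOperator
import Literature.Barriers.FinalStateConjecture.ExtremalHorizonShellEnergyDecay
import HarnessLib

/-!
# Barrier catalogue `FinalStateConjecture`: Aretakis's pointwise horizon decay (JFA 2012, Thm. 5)
# from the energy statements of the paper (Thms. 1–2) — the assembled reduction
# (`Literature/Barriers/FinalStateConjecture/`, D-0021, D-0014; family `gr`)

The named fact `Literature.Barriers.FinalStateConjecture.Aretakis2012_pointwiseDecay`
(`ExtremalHorizonAxisymmetricDecay.lean`; Aretakis, JFA 263 (2012), Thm. 5: axisymmetric solutions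
of the wave equation on extremal Kerr with regular compactly supported data decay pointwise along
the future event horizon) is the one analytic input of Aretakis's horizon-instability theorem on
extremal Kerr in this catalogue (`ExtremalHorizonBlowupProofs.lean`). Its printed proof (loc. cit.
§15) rests on the three energy theorems of the paper (§3, Thms. 1–3, proved by the vector-field
method in §§8–14). The catalogue formalises §15 as a chain of PROVED reductions:

* `ExtremalHorizonSphereSobolev.lean` — Lemma 15.0.1 (spherical Sobolev inequality after
  commutation with the Carter operator, axisymmetric case): pointwise decay on `S_τ` from the decay
  of `∫∫ sin θ ψ²` and `∫∫ sin θ (Δ̸ψ)²` on `S_τ`;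
* `ExtremalHorizonCarterOperator.lean` (with `Geometry/Lorentzian/KerrStarWaveOperator.lean`,
  `KerrCarterCommutation.lean`) — §5.3: the radial Carter operator maps Aretakis's class of
  axisymmetric solutions to itself and `Δ̸ψ = −𝓡ψ − M² sin²θ TTψ` on `S_τ`, whence
  `Aretakis2012_pointwiseDecay_of_sphereL2Decay`: the fact follows from the `L²(S_τ)` decay of the
  class;
* `ExtremalHorizonSphereDecay.lean`, `ExtremalHorizonShellEnergyDecay.lean` — §15.2: the
  `L²(S_τ)` decay of a `C²` function from boundedness and integrated decay of its shell energies
  on the Kerr–Schild leaves (`Kerr.sphereL2Decay_of_shellEnergyStatements`).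

**This file assembles the chain.** `Aretakis2012_pointwiseDecay_of_energyStatements`: the named
fact holds as soon as every member `Φ` of the class satisfies, on the shells
`{M ≤ r ≤ R₂} ⊂ {t* = τ}` and for `τ ≥ τ₀`, the nine boundedness and integrated-decay statements
listed in the theorem (for `Φ` and its `T`-derivatives). Its `T`-commuted form
`Aretakis2012_pointwiseDecay_of_uniformBoundedness_of_integratedDecay` (**the apex of the chain**)
asks only, for every GLOBALLY smooth everywhere axisymmetric solution on `U₀ ⊇ {r ≥ M, t* ≥ 0}`
with localised data, for (i) `∫∫∫_M^{R₂} sin θ (Φ² + (∂_ρΦ)²) ≤ C` for `τ ≥ τ₀` and (ii) the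
integrability of `τ ↦ ∫∫∫_M^{R₂} sin θ (Φ² + (r − M)²(∂_ρΦ)²)` on `(τ₀, ∞)`: the class is closed
under `T` (`Kerr.timeDeriv_in_class`), and a member of Aretakis's class which is smooth on `U₀` only
is first replaced by the rotation average of a cut-off (`Kerr.rotAverage`), equal to `2πΦ` near
`{r ≥ M, t* ≥ 0}`. These two statements are the shape of Thm. 2 (uniform boundedness of the non-degenerate energy
`∫_{Σ_τ} J^N_μ[ψ]n^μ` and the near-horizon spacetime bound
`∫_{r ≤ 23M/21}[ψ² + (Tψ)² + (r − M)(Yψ)² + |∇̸ψ|²] ≤ C ∫_{Σ₀} J^N[ψ]n`) and Thm. 1 (integrated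
local energy decay on `{r ≥ r_e}`, non-degenerate in `ψ²` and `(∂_{r*}ψ)²`) of the source, applied
to `ψ` and `Tψ` (note `∂_ρ = Y + T` for the radial derivative along the leaves `{t* = const}`,
`t* = v − r`). The only new ingredient here is the passage from a function smooth on the open set
`U₀ ⊇ K = {r ≥ M, t* ≥ 0}` to a globally smooth one with the same values and derivatives near `K`
(`Kerr.exists_smooth_cutoff`, `Kerr.contDiff_cutoff_mul` of `ExtremalHorizonAxisymmetricProjection.lean`),
so that the shell integrals for `τ ≥ 0` are unchanged (`Kerr.shellIntegral_congr`,
`Kerr.shellPoint_mem_horizonFutureSet`). No named facts are introduced (D-0026); the energy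
statements are the explicit hypothesis `H`, i.e. exactly what remains between the catalogue and a
proof of `Aretakis2012_pointwiseDecay`: the vector-field estimates of §§8–13 of the source on the
extremal Kerr–Schild chart.

## References

* S. Aretakis, *Decay of axisymmetric solutions of the wave equation on extreme Kerr backgrounds*,
  J. Funct. Anal. 263 (2012) 2770–2831 (arXiv:1110.2006): §3 Thm. 1 (integrated local energy
  decay), Thm. 2 (uniform boundedness of non-degenerate energy), Thm. 5 (pointwise decay); §5.3
  (the Carter operator); §15 (pointwise estimates) (key `Aretakis2012`).
* S. Aretakis, *Horizon instability of extremal black holes*, Adv. Theor. Math. Phys. 19 (2015)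
  507–530 (arXiv:1206.6598), Thm. 3 (key `Aretakis2015`).
-/

noncomputable section

open Set Filter MeasureTheory intervalIntegral
open scoped Topology ContDiff Manifold

namespace Literature.Barriers.FinalStateConjecture

open Literature.Geometry.Lorentzian

namespace Kerr

/-- Shell integrals of integrands agreeing on the box `[R₁, R₂] × [0, π] × [0, 2π]` agree
(`R₁ ≤ R₂`). [folklore] -/
theorem shellIntegral_congr {R₁ R₂ : ℝ} (hR : R₁ ≤ R₂) {f g : ℝ → ℝ → ℝ → ℝ}
    (h : ∀ r ∈ Icc R₁ R₂, ∀ θ ∈ Icc (0 : ℝ) Real.pi, ∀ φ ∈ Icc (0 : ℝ) (2 * Real.pi),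
      f r θ φ = g r θ φ) :
    shellIntegral R₁ R₂ f = shellIntegral R₁ R₂ g := by
  unfold shellIntegral
  refine intervalIntegral.integral_congr fun φ hφ ↦ ?_
  rw [uIcc_of_le (by positivity)] at hφ
  refine intervalIntegral.integral_congr fun θ hθ ↦ ?_
  rw [uIcc_of_le Real.pi_pos.le] at hθ
  refine intervalIntegral.integral_congr fun r hr ↦ ?_
  rw [uIcc_of_le hR] at hr
  exact h r hr θ hθ φ hφ

/-- Shell points with `τ ≥ 0`, `r ≥ M > 0` lie in the closed set
`K = {r₊ ≤ r} ∩ {t* ≥ 0}` of the extremal chart. [cite: Aretakis2012, §2.5] -/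
theorem shellPoint_mem_horizonFutureSet {M τ r : ℝ} (hM : 0 < M) (hτ : 0 ≤ τ) (hr : M ≤ r)
    (θ φ : ℝ) :
    shellPoint M τ r θ φ ∈ {x : E4 | Kerr.rPlus M M ≤ Kerr.radius M x ∧ 0 ≤ x 0} := by
  refine ⟨?_, ?_⟩
  · show Kerr.rPlus M M ≤ Kerr.radius M (shellPoint M τ r θ φ)
    rw [Kerr.rPlus_self, radius_shellPoint M τ (hM.trans_le hr) θ φ]
    exact hr
  · show 0 ≤ (shellPoint M τ r θ φ) 0
    rw [shellPoint_apply_zero]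
    exact hτ

end Kerr

/-- **Aretakis's pointwise horizon decay from the energy statements of the paper (the assembled
reduction).** The named fact `Aretakis2012_pointwiseDecay` (Aretakis, JFA 263 (2012), Thm. 5:
`|ψ| → 0` along `𝓗⁺` for axisymmetric solutions on extremal Kerr with regular compactly supported
data) follows from the following ENERGY STATEMENTS for the members `Φ` of Aretakis's class
(functions `C^∞` on an open set `U₀ ⊇ {r ≥ M, t* ≥ 0}` of the Kerr–Schild chart, axisymmetric on
`{r > 0}`, solving `□_{g_{M,M}} Φ = 0` on `U₀`, with data supported in a ball): for some
`M < R₁ < R₂`, `τ₀`, `C`, writing `p = Kerr.shellPoint M τ r θ φ`, `∂_ρΦ = dΦ(p)(0, n̂)`,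
`TΦ = dΦ(p)∂_{t*}`, `T∂_ρΦ = D²Φ(p)(∂_{t*}, (0, n̂))` and `∫∫∫_a^b (·) =
∫₀^{2π}∫₀^π∫_a^b sin θ (·) dr dθ dφ` (`Kerr.shellIntegral`),
* (boundedness, `τ ≥ τ₀`) `∫∫∫_M^{R₁} (∂_ρΦ)², ∫∫∫_M^{R₁} (T∂_ρΦ)², ∫∫∫_{R₁}^{R₂} Φ²,
  ∫∫∫_{R₁}^{R₂} (TΦ)², ∫∫∫_{R₁}^{R₂} (∂_ρΦ)², ∫∫∫_{R₁}^{R₂} (T∂_ρΦ)² ≤ C` — the uniform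
  boundedness of the non-degenerate energy of `ψ` and `Tψ`, Thm. 2 of the source;
* (integrated decay) `τ ↦ ∫∫∫_M^{R₁} (r − M)²(∂_ρΦ)²`, `τ ↦ ∫∫∫_{R₁}^{R₂} Φ²`,
  `τ ↦ ∫∫∫_{R₁}^{R₂} (∂_ρΦ)²` integrable on `(τ₀, ∞)` — the integrated local energy decay
  statements of Thm. 2 (near `𝓗⁺`, degenerate weight `(r − M)` on the transversal derivative) and
  Thm. 1 (away from `𝓗⁺`) of the source.
Proof: `Aretakis2012_pointwiseDecay_of_sphereL2Decay` (Lemma 15.0.1 after commutation with the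
Carter operator, `ExtremalHorizonSphereSobolev.lean` + `ExtremalHorizonCarterOperator.lean`) reduces
the fact to the `L²(S_τ)` decay of `Φ`; a smooth cutoff (`Kerr.exists_smooth_cutoff`) replaces `Φ`
by a globally smooth function agreeing with it near `{r ≥ M, t* ≥ 0}` (same shell integrals for
`τ ≥ 0`), and `Kerr.sphereL2Decay_of_shellEnergyStatements` (`ExtremalHorizonShellEnergyDecay.lean`)
gives the `L²(S_τ)` decay. No named facts are introduced (D-0026): the energy statements are the
hypothesis `H`, to be discharged by the vector-field estimates of the source (§§8–13).
[cite: Aretakis2012, Thms. 1, 2, 5 and §15] -/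
theorem Aretakis2012_pointwiseDecay_of_energyStatements
    (H : ∀ [Kerr.Facts] [Kerr.SliceFacts] (M : ℝ), 0 < M → ∀ r₀ ∈ Set.Ioo 0 M,
      ∀ (U₀ : Set (Kerr.region M r₀)) (Φ : E4 → ℝ), IsOpen U₀ →
        {x : Kerr.region M r₀ | Kerr.rPlus M M ≤ Kerr.radius M (x : E4) ∧ 0 ≤ (x : E4) 0} ⊆ U₀ →
        (∀ x ∈ U₀, ContDiffAt ℝ ∞ Φ x) →
        (∀ x ∈ U₀, (Kerr.smoothMetric M M r₀).toPseudoRiemannianMetric.dalembertian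
          (fun y : Kerr.region M r₀ ↦ Φ y) x = 0) →
        (∃ ρ : ℝ, ∀ x ∈ U₀, (x : E4) 0 = 0 → ρ < E4.spatialNorm (x : E4) →
          Φ x = 0 ∧ fderiv ℝ Φ x = 0) →
        (∀ (β : ℝ) (z : E4), 0 < Kerr.radius M z → Φ (E4.axialRotation β z) = Φ z) →
        ∃ R₁ R₂ τ₀ C : ℝ, M < R₁ ∧ R₁ < R₂ ∧
          (∀ τ : ℝ, τ₀ ≤ τ → Kerr.shellIntegral M R₁ (fun r θ φ ↦ Real.sin θ *
            (fderiv ℝ Φ (Kerr.shellPoint M τ r θ φ) (E4.spaceEmbed (sphRadial θ φ))) ^ 2) ≤ C) ∧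
          (∀ τ : ℝ, τ₀ ≤ τ → Kerr.shellIntegral M R₁ (fun r θ φ ↦ Real.sin θ *
            (fderiv ℝ (fderiv ℝ Φ) (Kerr.shellPoint M τ r θ φ) (E4.basisVector 0)
              (E4.spaceEmbed (sphRadial θ φ))) ^ 2) ≤ C) ∧
          (∀ τ : ℝ, τ₀ ≤ τ → Kerr.shellIntegral R₁ R₂ (fun r θ φ ↦ Real.sin θ *
            Φ (Kerr.shellPoint M τ r θ φ) ^ 2) ≤ C) ∧
          (∀ τ : ℝ, τ₀ ≤ τ → Kerr.shellIntegral R₁ R₂ (fun r θ φ ↦ Real.sin θ *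
            (fderiv ℝ Φ (Kerr.shellPoint M τ r θ φ) (E4.basisVector 0)) ^ 2) ≤ C) ∧
          (∀ τ : ℝ, τ₀ ≤ τ → Kerr.shellIntegral R₁ R₂ (fun r θ φ ↦ Real.sin θ *
            (fderiv ℝ Φ (Kerr.shellPoint M τ r θ φ) (E4.spaceEmbed (sphRadial θ φ))) ^ 2) ≤ C) ∧
          (∀ τ : ℝ, τ₀ ≤ τ → Kerr.shellIntegral R₁ R₂ (fun r θ φ ↦ Real.sin θ *
            (fderiv ℝ (fderiv ℝ Φ) (Kerr.shellPoint M τ r θ φ) (E4.basisVector 0)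
              (E4.spaceEmbed (sphRadial θ φ))) ^ 2) ≤ C) ∧
          IntegrableOn (fun τ ↦ Kerr.shellIntegral M R₁ (fun r θ φ ↦ Real.sin θ * ((r - M) ^ 2 *
            (fderiv ℝ Φ (Kerr.shellPoint M τ r θ φ) (E4.spaceEmbed (sphRadial θ φ))) ^ 2)))
            (Ioi τ₀) ∧
          IntegrableOn (fun τ ↦ Kerr.shellIntegral R₁ R₂ (fun r θ φ ↦ Real.sin θ *
            Φ (Kerr.shellPoint M τ r θ φ) ^ 2)) (Ioi τ₀) ∧
          IntegrableOn (fun τ ↦ Kerr.shellIntegral R₁ R₂ (fun r θ φ ↦ Real.sin θ *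
            (fderiv ℝ Φ (Kerr.shellPoint M τ r θ φ) (E4.spaceEmbed (sphRadial θ φ))) ^ 2))
            (Ioi τ₀)) :
    Aretakis2012_pointwiseDecay := by
  refine Aretakis2012_pointwiseDecay_of_sphereL2Decay ?_
  intro _ _ M hM r₀ hr₀ U₀ Φ hU₀ hKU hΦ hsol hloc haxi
  obtain ⟨R₁, R₂, τ₀, C, hR₁, hR₂, hB₁, hB₂, hB₃, hB₄, hB₅, hB₆, hI₁, hI₂, hI₃⟩ :=
    H M hM r₀ hr₀ U₀ Φ hU₀ hKU hΦ hsol hloc haxi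
  obtain ⟨hr₀pos, hr₀M⟩ := hr₀
  have hMR₁ : M ≤ R₁ := hR₁.le
  have hR₁₂ : R₁ ≤ R₂ := hR₂.le
  /- Step 1: a globally smooth function `G` agreeing with `Φ` near `K = {r ≥ M, t* ≥ 0}` -/
  set V : Set E4 := Subtype.val '' U₀ with hVdef
  have hV : IsOpen V := (Kerr.region M r₀).isOpen.isOpenMap_subtype_val U₀ hU₀
  have hΦV : ∀ x ∈ V, ContDiffAt ℝ ∞ Φ x := by
    rintro x ⟨y, hyU, rfl⟩
    exact hΦ y hyU
  set K' : Set E4 := {x : E4 | Kerr.rPlus M M ≤ Kerr.radius M x ∧ 0 ≤ x 0} with hK'def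
  have hK'c : IsClosed K' := Kerr.isClosed_horizonFutureSet M M
  have hK'reg : ∀ x ∈ K', x ∈ Kerr.region M r₀ := by
    intro x hx
    rw [Kerr.mem_region]
    have h1 : Kerr.rPlus M M ≤ Kerr.radius M x := hx.1
    rw [Kerr.rPlus_self] at h1
    exact max_lt (by linarith) (by linarith)
  have hK'V : K' ⊆ V := fun x hx ↦ ⟨⟨x, hK'reg x hx⟩, hKU hx, rfl⟩
  obtain ⟨χ, N, hχ, hN, hKN, -, hχ1, hχsupp⟩ := Kerr.exists_smooth_cutoff hK'c hV hK'V
  set G : E4 → ℝ := fun z ↦ χ z * Φ z with hGdef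
  have hG : ContDiff ℝ ∞ G := Kerr.contDiff_cutoff_mul hχ hχsupp hΦV
  have hG2 : ContDiff ℝ 2 G := hG.of_le (WithTop.coe_le_coe.mpr le_top)
  have hGN : EqOn G Φ N := fun z hz ↦ by
    show χ z * Φ z = Φ z
    rw [hχ1 z hz, one_mul]
  have hfd : ∀ z ∈ N, fderiv ℝ G z = fderiv ℝ Φ z := fun z hz ↦
    (hGN.eventuallyEq_of_mem (hN.mem_nhds hz)).fderiv_eq
  have hfd2 : ∀ z ∈ N, fderiv ℝ (fderiv ℝ G) z = fderiv ℝ (fderiv ℝ Φ) z := by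
    intro z hz
    have hev : fderiv ℝ G =ᶠ[𝓝 z] fderiv ℝ Φ := by
      filter_upwards [hN.mem_nhds hz] with y hy using hfd y hy
    exact hev.fderiv_eq
  -- shell points with `τ ≥ 0`, `r ≥ M` lie in `N`
  have hshellN : ∀ τ r θ φ, 0 ≤ τ → M ≤ r → Kerr.shellPoint M τ r θ φ ∈ N :=
    fun τ r θ φ hτ hr ↦ hKN (Kerr.shellPoint_mem_horizonFutureSet hM hτ hr θ φ)
  /- Step 2: the energy statements transfer to `G` for `τ ≥ τ₀' = max τ₀ 0` -/
  set τ₀' : ℝ := max τ₀ 0 with hτ₀'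
  have hτ₀'0 : 0 ≤ τ₀' := le_max_right _ _
  have hτ₀'τ₀ : τ₀ ≤ τ₀' := le_max_left _ _
  -- pointwise identities on the two boxes, for `τ ≥ 0`
  have e0 : ∀ τ, 0 ≤ τ → ∀ a b, M ≤ a → ∀ r ∈ Icc a b, ∀ θ φ : ℝ,
      G (Kerr.shellPoint M τ r θ φ) = Φ (Kerr.shellPoint M τ r θ φ) :=
    fun τ hτ a b ha r hr θ φ ↦ hGN (hshellN τ r θ φ hτ (ha.trans hr.1))
  have e1 : ∀ τ, 0 ≤ τ → ∀ a b, M ≤ a → ∀ r ∈ Icc a b, ∀ θ φ : ℝ, ∀ v : E4,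
      fderiv ℝ G (Kerr.shellPoint M τ r θ φ) v = fderiv ℝ Φ (Kerr.shellPoint M τ r θ φ) v :=
    fun τ hτ a b ha r hr θ φ v ↦ by rw [hfd _ (hshellN τ r θ φ hτ (ha.trans hr.1))]
  have e2 : ∀ τ, 0 ≤ τ → ∀ a b, M ≤ a → ∀ r ∈ Icc a b, ∀ θ φ : ℝ, ∀ v w : E4,
      fderiv ℝ (fderiv ℝ G) (Kerr.shellPoint M τ r θ φ) v w =
        fderiv ℝ (fderiv ℝ Φ) (Kerr.shellPoint M τ r θ φ) v w :=
    fun τ hτ a b ha r hr θ φ v w ↦ by rw [hfd2 _ (hshellN τ r θ φ hτ (ha.trans hr.1))]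
  -- the six bounds
  have hB₁' : ∀ τ : ℝ, τ₀' ≤ τ → Kerr.shellIntegral M R₁ (fun r θ φ ↦ Real.sin θ *
      (fderiv ℝ G (Kerr.shellPoint M τ r θ φ) (E4.spaceEmbed (sphRadial θ φ))) ^ 2) ≤ C := by
    intro τ hτ
    rw [Kerr.shellIntegral_congr hMR₁ fun r hr θ _ φ _ ↦ by
      rw [e1 τ (hτ₀'0.trans hτ) M R₁ le_rfl r hr θ φ]]
    exact hB₁ τ (hτ₀'τ₀.trans hτ)
  have hB₂' : ∀ τ : ℝ, τ₀' ≤ τ → Kerr.shellIntegral M R₁ (fun r θ φ ↦ Real.sin θ *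
      (fderiv ℝ (fderiv ℝ G) (Kerr.shellPoint M τ r θ φ) (E4.basisVector 0)
        (E4.spaceEmbed (sphRadial θ φ))) ^ 2) ≤ C := by
    intro τ hτ
    rw [Kerr.shellIntegral_congr hMR₁ fun r hr θ _ φ _ ↦ by
      rw [e2 τ (hτ₀'0.trans hτ) M R₁ le_rfl r hr θ φ]]
    exact hB₂ τ (hτ₀'τ₀.trans hτ)
  have hB₃' : ∀ τ : ℝ, τ₀' ≤ τ → Kerr.shellIntegral R₁ R₂ (fun r θ φ ↦ Real.sin θ *
      G (Kerr.shellPoint M τ r θ φ) ^ 2) ≤ C := by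
    intro τ hτ
    rw [Kerr.shellIntegral_congr hR₁₂ fun r hr θ _ φ _ ↦ by
      rw [e0 τ (hτ₀'0.trans hτ) R₁ R₂ hMR₁ r hr θ φ]]
    exact hB₃ τ (hτ₀'τ₀.trans hτ)
  have hB₄' : ∀ τ : ℝ, τ₀' ≤ τ → Kerr.shellIntegral R₁ R₂ (fun r θ φ ↦ Real.sin θ *
      (fderiv ℝ G (Kerr.shellPoint M τ r θ φ) (E4.basisVector 0)) ^ 2) ≤ C := by
    intro τ hτ
    rw [Kerr.shellIntegral_congr hR₁₂ fun r hr θ _ φ _ ↦ by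
      rw [e1 τ (hτ₀'0.trans hτ) R₁ R₂ hMR₁ r hr θ φ]]
    exact hB₄ τ (hτ₀'τ₀.trans hτ)
  have hB₅' : ∀ τ : ℝ, τ₀' ≤ τ → Kerr.shellIntegral R₁ R₂ (fun r θ φ ↦ Real.sin θ *
      (fderiv ℝ G (Kerr.shellPoint M τ r θ φ) (E4.spaceEmbed (sphRadial θ φ))) ^ 2) ≤ C := by
    intro τ hτ
    rw [Kerr.shellIntegral_congr hR₁₂ fun r hr θ _ φ _ ↦ by
      rw [e1 τ (hτ₀'0.trans hτ) R₁ R₂ hMR₁ r hr θ φ]]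
    exact hB₅ τ (hτ₀'τ₀.trans hτ)
  have hB₆' : ∀ τ : ℝ, τ₀' ≤ τ → Kerr.shellIntegral R₁ R₂ (fun r θ φ ↦ Real.sin θ *
      (fderiv ℝ (fderiv ℝ G) (Kerr.shellPoint M τ r θ φ) (E4.basisVector 0)
        (E4.spaceEmbed (sphRadial θ φ))) ^ 2) ≤ C := by
    intro τ hτ
    rw [Kerr.shellIntegral_congr hR₁₂ fun r hr θ _ φ _ ↦ by
      rw [e2 τ (hτ₀'0.trans hτ) R₁ R₂ hMR₁ r hr θ φ]]
    exact hB₆ τ (hτ₀'τ₀.trans hτ)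
  -- the three integrability statements
  have hsub : Ioi τ₀' ⊆ Ioi τ₀ := Ioi_subset_Ioi hτ₀'τ₀
  have hpos : ∀ τ ∈ Ioi τ₀', 0 ≤ τ := fun τ hτ ↦ hτ₀'0.trans (le_of_lt hτ)
  have hI₁' : IntegrableOn (fun τ ↦ Kerr.shellIntegral M R₁ (fun r θ φ ↦ Real.sin θ * ((r - M) ^ 2 *
      (fderiv ℝ G (Kerr.shellPoint M τ r θ φ) (E4.spaceEmbed (sphRadial θ φ))) ^ 2))) (Ioi τ₀') := by
    refine (hI₁.mono_set hsub).congr_fun (fun τ hτ ↦ ?_) measurableSet_Ioi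
    exact Kerr.shellIntegral_congr hMR₁ fun r hr θ _ φ _ ↦ by
      rw [e1 τ (hpos τ hτ) M R₁ le_rfl r hr θ φ]
  have hI₂' : IntegrableOn (fun τ ↦ Kerr.shellIntegral R₁ R₂ (fun r θ φ ↦ Real.sin θ *
      G (Kerr.shellPoint M τ r θ φ) ^ 2)) (Ioi τ₀') := by
    refine (hI₂.mono_set hsub).congr_fun (fun τ hτ ↦ ?_) measurableSet_Ioi
    exact Kerr.shellIntegral_congr hR₁₂ fun r hr θ _ φ _ ↦ by
      rw [e0 τ (hpos τ hτ) R₁ R₂ hMR₁ r hr θ φ]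
  have hI₃' : IntegrableOn (fun τ ↦ Kerr.shellIntegral R₁ R₂ (fun r θ φ ↦ Real.sin θ *
      (fderiv ℝ G (Kerr.shellPoint M τ r θ φ) (E4.spaceEmbed (sphRadial θ φ))) ^ 2)) (Ioi τ₀') := by
    refine (hI₃.mono_set hsub).congr_fun (fun τ hτ ↦ ?_) measurableSet_Ioi
    exact Kerr.shellIntegral_congr hR₁₂ fun r hr θ _ φ _ ↦ by
      rw [e1 τ (hpos τ hτ) R₁ R₂ hMR₁ r hr θ φ]
  /- Step 3: `L²(S_τ)` decay for `G`, hence for `Φ` -/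
  have hdec := Kerr.sphereL2Decay_of_shellEnergyStatements hR₁ hR₂ hG2 hB₁' hB₂' hB₃' hB₄' hB₅' hB₆'
    hI₁' hI₂' hI₃'
  intro ε hε
  obtain ⟨τ₁, hτ₁⟩ := hdec ε hε
  refine ⟨max τ₁ 0, fun τ hτ ↦ ?_⟩
  have h := hτ₁ τ ((le_max_left _ _).trans hτ)
  have hτ0 : 0 ≤ τ := (le_max_right _ _).trans hτ
  have hpt : ∀ θ φ : ℝ, G (Kerr.horizonPoint M τ θ φ) = Φ (Kerr.horizonPoint M τ θ φ) := by
    intro θ φ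
    rw [← Kerr.shellPoint_self]
    exact hGN (hshellN τ M θ φ hτ0 le_rfl)
  simpa only [hpt] using h

namespace Kerr

/-! ### More calculus of shell integrals: sub-intervals, continuity in a parameter, domination -/

/-- **Monotonicity of the shell integral in the `r`-interval** for a nonnegative jointly continuous
integrand: `[a, b] ⊆ [c, d]` gives `∫∫∫_a^b g ≤ ∫∫∫_c^d g`. [folklore] -/
theorem shellIntegral_mono_interval {a b c d : ℝ} (hca : c ≤ a) (hab : a ≤ b) (hbd : b ≤ d)
    {g : ℝ → ℝ → ℝ → ℝ} (hg : Continuous fun q : ℝ × ℝ × ℝ ↦ g q.1 q.2.1 q.2.2)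
    (h0 : ∀ r ∈ Icc c d, ∀ θ ∈ Icc (0 : ℝ) Real.pi, ∀ φ ∈ Icc (0 : ℝ) (2 * Real.pi), 0 ≤ g r θ φ) :
    shellIntegral a b g ≤ shellIntegral c d g := by
  unfold shellIntegral
  refine sphereIntegral_mono_on (continuous_inner_of_continuous hg) (continuous_inner_of_continuous hg)
    fun θ hθ φ hφ ↦ ?_
  have hgr : Continuous fun r ↦ g r θ φ :=
    hg.comp (Continuous.prodMk continuous_id (Continuous.prodMk continuous_const continuous_const))
  refine intervalIntegral.integral_mono_interval hca hab hbd ?_ (hgr.intervalIntegrable _ _)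
  filter_upwards [ae_restrict_mem measurableSet_Ioc] with r hr
  exact h0 r ⟨hr.1.le, hr.2⟩ θ hθ φ hφ

/-- **Continuity of a shell integral in a parameter**: for `H(s, r, θ, φ)` jointly continuous,
`s ↦ ∫∫∫ H(s, ·)` is continuous. [folklore] -/
theorem continuous_shellIntegral {R₁ R₂ : ℝ} {H : ℝ → ℝ → ℝ → ℝ → ℝ}
    (hH : Continuous fun q : ℝ × ℝ × ℝ × ℝ ↦ H q.1 q.2.1 q.2.2.1 q.2.2.2) :
    Continuous fun s ↦ shellIntegral R₁ R₂ (fun r θ φ ↦ H s r θ φ) := by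
  unfold shellIntegral
  have hIr : Continuous fun q : ℝ × ℝ × ℝ ↦ ∫ r in R₁..R₂, H q.1 r q.2.1 q.2.2 := by
    have h : Continuous (Function.uncurry fun (q : ℝ × ℝ × ℝ) r ↦ H q.1 r q.2.1 q.2.2) :=
      hH.comp (Continuous.prodMk (continuous_fst.comp continuous_fst) (Continuous.prodMk continuous_snd
        (Continuous.prodMk (continuous_fst.comp (continuous_snd.comp continuous_fst))
          (continuous_snd.comp (continuous_snd.comp continuous_fst)))))
    exact intervalIntegral.continuous_parametric_intervalIntegral_of_continuous' h R₁ R₂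
  have hIθ : Continuous fun q : ℝ × ℝ ↦ ∫ θ in (0 : ℝ)..Real.pi, ∫ r in R₁..R₂, H q.1 r θ q.2 := by
    have h : Continuous (Function.uncurry fun (q : ℝ × ℝ) θ ↦ ∫ r in R₁..R₂, H q.1 r θ q.2) :=
      hIr.comp (Continuous.prodMk (continuous_fst.comp continuous_fst) (Continuous.prodMk continuous_snd
        (continuous_snd.comp continuous_fst)))
    exact intervalIntegral.continuous_parametric_intervalIntegral_of_continuous' h 0 Real.pi
  have h : Continuous (Function.uncurry fun s φ ↦ ∫ θ in (0 : ℝ)..Real.pi, ∫ r in R₁..R₂, H s r θ φ) :=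
    hIθ
  exact intervalIntegral.continuous_parametric_intervalIntegral_of_continuous' h 0 (2 * Real.pi)

/-- **Domination**: a continuous nonnegative function bounded on `(τ₀, ∞)` by an integrable one is
integrable there. [folklore] -/
theorem integrableOn_Ioi_of_le {f g : ℝ → ℝ} {τ₀ : ℝ} (hg : IntegrableOn g (Ioi τ₀)) (hf : Continuous f)
    (h0 : ∀ τ ∈ Ioi τ₀, 0 ≤ f τ) (hle : ∀ τ ∈ Ioi τ₀, f τ ≤ g τ) : IntegrableOn f (Ioi τ₀) := by
  refine Integrable.mono' hg hf.aestronglyMeasurable ?_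
  filter_upwards [ae_restrict_mem measurableSet_Ioi] with τ hτ
  rw [Real.norm_eq_abs, abs_of_nonneg (h0 τ hτ)]
  exact hle τ hτ

/-- The derivative of `TΨ = dΨ(·)∂_{t*}` in a direction `v` is `D²Ψ(p)(v, ∂_{t*})`. [folklore] -/
theorem fderiv_timeDeriv_apply {Ψ : E4 → ℝ} (hΨ : ContDiff ℝ 2 Ψ) (p v : E4) :
    fderiv ℝ (fun y ↦ fderiv ℝ Ψ y (E4.basisVector 0)) p v =
      fderiv ℝ (fderiv ℝ Ψ) p v (E4.basisVector 0) := by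
  have hd : DifferentiableAt ℝ (fderiv ℝ Ψ) p :=
    ((hΨ.fderiv_right (m := 1) le_rfl).differentiable one_ne_zero).differentiableAt
  exact fderiv_clm_apply_const_apply hd (E4.basisVector 0) v

/-- Symmetry of the second derivative of a `C²` function on `E4`. [folklore] -/
theorem fderiv_fderiv_symm {Ψ : E4 → ℝ} (hΨ : ContDiff ℝ 2 Ψ) (p u v : E4) :
    fderiv ℝ (fderiv ℝ Ψ) p u v = fderiv ℝ (fderiv ℝ Ψ) p v u := by
  have h : minSmoothness ℝ 2 ≤ (2 : WithTop ℕ∞) := by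
    rw [minSmoothness_of_isRCLikeNormedField]
  exact (hΨ.contDiffAt.isSymmSndFDerivAt h).eq u v

/-- **On the orbit of a horizon point with `τ ≥ 0` under the rotations, the rotation average of a
function agreeing near `K` with a function axisymmetric on `{r > 0}` is `2π` times that function.**
[cite: Aretakis2012, §3 (axisymmetric solutions)] -/
theorem rotAverage_horizonPoint_eq {M : ℝ} (hM : 0 < M) {G Φ : E4 → ℝ} {N : Set E4}
    (hGN : EqOn G Φ N) (hKN : {x : E4 | Kerr.rPlus M M ≤ Kerr.radius M x ∧ 0 ≤ x 0} ⊆ N)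
    (haxi : ∀ (β : ℝ) (z : E4), 0 < Kerr.radius M z → Φ (E4.axialRotation β z) = Φ z)
    {τ : ℝ} (hτ : 0 ≤ τ) (θ φ : ℝ) :
    rotAverage G (horizonPoint M τ θ φ) = 2 * Real.pi * Φ (horizonPoint M τ θ φ) := by
  have hxK : horizonPoint M τ θ φ ∈ {x : E4 | Kerr.rPlus M M ≤ Kerr.radius M x ∧ 0 ≤ x 0} := by
    rw [← shellPoint_self]
    exact shellPoint_mem_horizonFutureSet hM hτ le_rfl θ φ
  have horb : ∀ α, E4.axialRotation α (horizonPoint M τ θ φ) ∈ N := fun α ↦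
    hKN (Kerr.axialRotation_mem_horizonFutureSet_iff.mpr hxK)
  rw [rotAverage_apply_of_forall_mem hGN horb]
  have hpos : 0 < Kerr.radius M (horizonPoint M τ θ φ) := by
    rw [radius_horizonPoint hM.le]; exact hM
  have h : ∀ α, Φ (E4.axialRotation α (horizonPoint M τ θ φ)) = Φ (horizonPoint M τ θ φ) :=
    fun α ↦ haxi α _ hpos
  simp only [h, intervalIntegral.integral_const, smul_eq_mul, sub_zero]

end Kerr

namespace Kerr

/-- Sub-interval and pointwise comparison combined: `[a, b] ⊆ [c, d]`, `0 ≤ f ≤ g` on the big box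
gives `∫∫∫_a^b f ≤ ∫∫∫_c^d g`. [folklore] -/
theorem shellIntegral_le_of_subinterval {a b c d : ℝ} (hca : c ≤ a) (hab : a ≤ b) (hbd : b ≤ d)
    {f g : ℝ → ℝ → ℝ → ℝ} (hf : Continuous fun q : ℝ × ℝ × ℝ ↦ f q.1 q.2.1 q.2.2)
    (hg : Continuous fun q : ℝ × ℝ × ℝ ↦ g q.1 q.2.1 q.2.2)
    (h0 : ∀ r ∈ Icc c d, ∀ θ ∈ Icc (0 : ℝ) Real.pi, ∀ φ ∈ Icc (0 : ℝ) (2 * Real.pi), 0 ≤ f r θ φ)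
    (hle : ∀ r ∈ Icc c d, ∀ θ ∈ Icc (0 : ℝ) Real.pi, ∀ φ ∈ Icc (0 : ℝ) (2 * Real.pi),
      f r θ φ ≤ g r θ φ) :
    shellIntegral a b f ≤ shellIntegral c d g :=
  (shellIntegral_mono_interval hca hab hbd hf h0).trans
    (shellIntegral_mono_on (hca.trans (hab.trans hbd)) hf hg hle)

end Kerr

/-- **Aretakis's pointwise horizon decay from uniform boundedness and integrated local energy
decay (the assembled reduction, `T`-commuted form).** The named fact `Aretakis2012_pointwiseDecay`
(Aretakis, JFA 263 (2012), Thm. 5) holds as soon as every GLOBALLY smooth, everywhere axisymmetric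
`Φ : E4 → ℝ` solving `□_{g_{M,M}} Φ = 0` on an open set `U₀ ⊇ {r ≥ M, t* ≥ 0}` of the extremal
Kerr–Schild chart, with data vanishing outside a ball of the initial leaf, satisfies for some
`R₂ > M`, `τ₀`, `C` (with `p = Kerr.shellPoint M τ r θ φ`, `∂_ρΦ = dΦ(p)(0, n̂(θ, φ))`,
`∫∫∫ = ∫₀^{2π}∫₀^π∫_M^{R₂} · dr dθ dφ`):
* (uniform boundedness) `∫∫∫ sin θ (Φ² + (∂_ρΦ)²)(p) ≤ C` for `τ ≥ τ₀` — in the source the uniform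
  boundedness of the non-degenerate energy, Thm. 2: `∫_{Σ_τ} J^N_μ[ψ]n^μ ≤ C ∫_{Σ₀} J^N_μ[ψ]n^μ`
  with `J^N_μ[ψ]n^μ ∼ (Tψ)² + (Yψ)² + |∇̸ψ|²`, `∂_ρ = T + Y`, the zeroth-order term by a Hardy
  inequality;
* (integrated local energy decay) `τ ↦ ∫∫∫ sin θ (Φ² + (r − M)²(∂_ρΦ)²)(p)` is integrable on
  `(τ₀, ∞)` — in the source Thm. 2, `∫_{𝓐∩{r ≤ 23M/21}} [ψ² + (Tψ)² + (r − M)(Yψ)² + |∇̸ψ|²] ≤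
  C ∫_{Σ₀} J^N[ψ]n`, and Thm. 1 on `{r ≥ r_e}` (non-degenerate in `ψ²`, `(∂_{r*}ψ)²`; the
  `T`-derivative degenerates only at `r = (1 + √2)M > 23M/21`).
Compared with `Aretakis2012_pointwiseDecay_of_energyStatements` the statements for `TΦ` are not
separate hypotheses: the class is closed under `T` (`Kerr.timeDeriv_in_class`), and the given member
of Aretakis's class (smooth on `U₀` only, axisymmetric on `{r > 0}`) is first replaced by the
rotation average of a cut-off (`Kerr.rotAverage`, `Kerr.dalembertian_rotAverage_eq_zero` of
`ExtremalHorizonAxisymmetricProjection.lean`), which is `2π Φ` near `{r ≥ M, t* ≥ 0}`. No named facts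
are introduced (D-0026); the two displayed statements, for this class, are what remains between the
catalogue and `Aretakis2012_pointwiseDecay` — the vector-field estimates of §§8–13 of the source.
[cite: Aretakis2012, Thms. 1, 2, 5 and §15] -/
theorem Aretakis2012_pointwiseDecay_of_uniformBoundedness_of_integratedDecay
    (H : ∀ [Kerr.Facts] [Kerr.SliceFacts] (M : ℝ), 0 < M → ∀ r₀ ∈ Set.Ioo 0 M,
      ∀ (U₀ : Set (Kerr.region M r₀)) (Φ : E4 → ℝ), IsOpen U₀ →
        {x : Kerr.region M r₀ | Kerr.rPlus M M ≤ Kerr.radius M (x : E4) ∧ 0 ≤ (x : E4) 0} ⊆ U₀ →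
        ContDiff ℝ ∞ Φ →
        (∀ x ∈ U₀, (Kerr.smoothMetric M M r₀).toPseudoRiemannianMetric.dalembertian
          (fun y : Kerr.region M r₀ ↦ Φ y) x = 0) →
        (∃ ρ : ℝ, ∀ x ∈ U₀, (x : E4) 0 = 0 → ρ < E4.spatialNorm (x : E4) →
          Φ x = 0 ∧ fderiv ℝ Φ x = 0) →
        (∀ (β : ℝ) (z : E4), Φ (E4.axialRotation β z) = Φ z) →
        ∃ R₂ τ₀ C : ℝ, M < R₂ ∧
          (∀ τ : ℝ, τ₀ ≤ τ → Kerr.shellIntegral M R₂ (fun r θ φ ↦ Real.sin θ *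
            (Φ (Kerr.shellPoint M τ r θ φ) ^ 2 +
              (fderiv ℝ Φ (Kerr.shellPoint M τ r θ φ) (E4.spaceEmbed (sphRadial θ φ))) ^ 2)) ≤ C) ∧
          IntegrableOn (fun τ ↦ Kerr.shellIntegral M R₂ (fun r θ φ ↦ Real.sin θ *
            (Φ (Kerr.shellPoint M τ r θ φ) ^ 2 + (r - M) ^ 2 *
              (fderiv ℝ Φ (Kerr.shellPoint M τ r θ φ) (E4.spaceEmbed (sphRadial θ φ))) ^ 2)))
            (Ioi τ₀)) :
    Aretakis2012_pointwiseDecay := by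
  refine Aretakis2012_pointwiseDecay_of_sphereL2Decay ?_
  intro _ _ M hM r₀ hr₀ U Φ hU hKU hΦ hsol hloc haxi
  obtain ⟨hr₀pos, hr₀M⟩ := hr₀
  obtain ⟨ρ, hρ⟩ := hloc
  have hπ := Real.pi_pos
  /- Step 1: cutoff and rotation average — a globally smooth, axisymmetric representative -/
  set ψ : Kerr.region M r₀ → ℝ := fun y ↦ Φ y with hψdef
  have hrepΦ : ∀ y : Kerr.region M r₀, ψ y = Φ y := fun _ ↦ rfl
  have hψ : ContMDiffOn 𝓘(ℝ, E4) 𝓘(ℝ, ℝ) ∞ ψ U := fun y hy ↦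
    ((OpensChart.contMDiffAt_iff y ψ Φ hrepΦ).mpr (hΦ y hy)).contMDiffWithinAt
  set V : Set E4 := Subtype.val '' U with hVdef
  have hV : IsOpen V := (Kerr.region M r₀).isOpen.isOpenMap_subtype_val U hU
  have hΦV : ∀ x ∈ V, ContDiffAt ℝ ∞ Φ x := by
    rintro x ⟨y, hyU, rfl⟩
    exact hΦ y hyU
  set K' : Set E4 := {x : E4 | Kerr.rPlus M M ≤ Kerr.radius M x ∧ 0 ≤ x 0} with hK'def
  have hK'c : IsClosed K' := Kerr.isClosed_horizonFutureSet M M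
  have hK'reg : ∀ x ∈ K', x ∈ Kerr.region M r₀ := by
    intro x hx
    rw [Kerr.mem_region]
    have h1 : Kerr.rPlus M M ≤ Kerr.radius M x := hx.1
    rw [Kerr.rPlus_self] at h1
    exact max_lt (by linarith) (by linarith)
  have hK'V : K' ⊆ V := fun x hx ↦ ⟨⟨x, hK'reg x hx⟩, hKU hx, rfl⟩
  obtain ⟨χ, N, hχ, hN, hKN, hNV, hχ1, hχsupp⟩ := Kerr.exists_smooth_cutoff hK'c hV hK'V
  set G : E4 → ℝ := fun z ↦ χ z * Φ z with hGdef
  have hG : ContDiff ℝ ∞ G := Kerr.contDiff_cutoff_mul hχ hχsupp hΦV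
  have hGN : EqOn G Φ N := fun z hz ↦ by
    show χ z * Φ z = Φ z
    rw [hχ1 z hz, one_mul]
  have hNU : ∀ z ∈ N, ∃ hz : z ∈ Kerr.region M r₀, (⟨z, hz⟩ : Kerr.region M r₀) ∈ U := by
    intro z hz
    obtain ⟨y, hyU, hyz⟩ := hNV hz
    subst hyz
    exact ⟨y.2, hyU⟩
  have hGN' : EqOn G (Function.extend Subtype.val ψ 0) N := by
    intro z hz
    obtain ⟨hz', _⟩ := hNU z hz
    rw [hGN hz, ← Kerr.extend_apply_coe ψ ⟨z, hz'⟩]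
  set U₀ : Set (Kerr.region M r₀) := {x | ∀ α : ℝ, E4.axialRotation α x ∈ N} with hU₀def
  have hU₀ : IsOpen U₀ :=
    (Kerr.isOpen_setOf_forall_axialRotation_mem hN).preimage continuous_subtype_val
  have hKU₀ : {x : Kerr.region M r₀ | Kerr.rPlus M M ≤ Kerr.radius M (x : E4) ∧ 0 ≤ (x : E4) 0} ⊆
      U₀ := by
    intro x hx α
    exact hKN (Kerr.axialRotation_mem_horizonFutureSet_iff.mpr hx)
  have hU₀N : ∀ x ∈ U₀, ∀ α, E4.axialRotation α (x : E4) ∈ N := fun x hx ↦ hx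
  set Ψ₀ : E4 → ℝ := Kerr.rotAverage G with hΨ₀def
  have hΨ₀ : ContDiff ℝ ∞ Ψ₀ := Kerr.contDiff_rotAverage hG
  have hΨ₀1 : ContDiff ℝ 1 Ψ₀ := hΨ₀.of_le (WithTop.coe_le_coe.mpr le_top)
  have hΨ₀2 : ContDiff ℝ 2 Ψ₀ := hΨ₀.of_le (WithTop.coe_le_coe.mpr le_top)
  have hsol₀ : ∀ x ∈ U₀, (Kerr.smoothMetric M M r₀).toPseudoRiemannianMetric.dalembertian
      (fun y : Kerr.region M r₀ ↦ Ψ₀ y) x = 0 :=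
    fun x hx ↦ Kerr.dalembertian_rotAverage_eq_zero hU hψ hsol hG hN hNU hGN' x (hU₀N x hx)
  have hloc₀ : ∀ x ∈ U₀, (x : E4) 0 = 0 → ρ < E4.spatialNorm (x : E4) →
      Ψ₀ x = 0 ∧ fderiv ℝ Ψ₀ x = 0 := by
    intro x hx hx0 hxρ
    have hzero : ∀ α, Φ (E4.axialRotation α x) = 0 ∧ fderiv ℝ Φ (E4.axialRotation α x) = 0 := by
      intro α
      obtain ⟨hz, hzU⟩ := hNU _ (hU₀N x hx α)
      exact hρ ⟨_, hz⟩ hzU (by simp [hx0]) (by simpa [E4.spatialNorm_axialRotation] using hxρ)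
    have hz1 : ∀ α, Φ (E4.axialRotation α x) = 0 := fun α ↦ (hzero α).1
    have hz2 : ∀ α, fderiv ℝ Φ (E4.axialRotation α x) = 0 := fun α ↦ (hzero α).2
    constructor
    · show Kerr.rotAverage G x = 0
      rw [Kerr.rotAverage_apply_of_forall_mem hGN (hU₀N x hx)]
      simp only [hz1, intervalIntegral.integral_zero]
    · ext v
      rw [Kerr.fderiv_rotAverage_apply_of_forall_mem hG hN hGN (hU₀N x hx)]
      simp only [hz2, _root_.zero_apply, intervalIntegral.integral_zero]
  have haxi₀ : ∀ β (x : E4), Ψ₀ (E4.axialRotation β x) = Ψ₀ x := fun β x ↦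
    Kerr.rotAverage_axialRotation G β x
  /- Step 2: `TΨ₀` is in the class; the hypothesis for `Ψ₀` and for `TΨ₀` -/
  obtain ⟨hT, hsolT, hlocT, haxiT⟩ := Kerr.timeDeriv_in_class hM.le hΨ₀ hU₀ hsol₀ hloc₀ haxi₀
  obtain ⟨R₂, τ₀, C, hR₂, hbd, hiled⟩ :=
    H M hM r₀ ⟨hr₀pos, hr₀M⟩ U₀ Ψ₀ hU₀ hKU₀ hΨ₀ hsol₀ ⟨ρ, hloc₀⟩ haxi₀
  obtain ⟨R₂', τ₀', C', hR₂', hbd', -⟩ :=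
    H M hM r₀ ⟨hr₀pos, hr₀M⟩ U₀ (fun y ↦ fderiv ℝ Ψ₀ y (E4.basisVector 0)) hU₀ hKU₀ hT hsolT
      ⟨ρ, hlocT⟩ haxiT
  /- Step 3: radii, constants, continuity -/
  set R : ℝ := min R₂ R₂' with hRdef
  have hMR : M < R := lt_min hR₂ hR₂'
  have hRR₂ : R ≤ R₂ := min_le_left _ _
  have hRR₂' : R ≤ R₂' := min_le_right _ _
  set R₁ : ℝ := (M + R) / 2 with hR₁def
  have hMR₁ : M < R₁ := by rw [hR₁def]; linarith
  have hR₁R : R₁ < R := by rw [hR₁def]; linarith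
  have hR₁M : 0 < R₁ - M := sub_pos.mpr hMR₁
  set τs : ℝ := max τ₀ τ₀' with hτsdef
  have hτs₀ : τ₀ ≤ τs := le_max_left _ _
  have hτs₀' : τ₀' ≤ τs := le_max_right _ _
  set Cm : ℝ := max C C' with hCmdef
  -- the second derivative `T∂_ρ = ∂_ρT`
  have hTD : ∀ (p : E4) (v : E4), fderiv ℝ (fderiv ℝ Ψ₀) p (E4.basisVector 0) v =
      fderiv ℝ (fun y ↦ fderiv ℝ Ψ₀ y (E4.basisVector 0)) p v := by
    intro p v
    rw [Kerr.fderiv_timeDeriv_apply hΨ₀2, Kerr.fderiv_fderiv_symm hΨ₀2]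
  -- joint continuity of the integrands
  have c4₀ : Continuous fun q : ℝ × ℝ × ℝ × ℝ ↦ Ψ₀ (Kerr.shellPoint M q.1 q.2.1 q.2.2.1 q.2.2.2) :=
    hΨ₀.continuous.comp (Kerr.continuous_shellPoint₄ M)
  have c4₁ : Continuous fun q : ℝ × ℝ × ℝ × ℝ ↦ fderiv ℝ Ψ₀ (Kerr.shellPoint M q.1 q.2.1 q.2.2.1 q.2.2.2)
      (E4.spaceEmbed (sphRadial q.2.2.1 q.2.2.2)) := Kerr.continuous_rhoDeriv_shellPoint₄ hΨ₀1 M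
  have c4T : Continuous fun q : ℝ × ℝ × ℝ × ℝ ↦ fderiv ℝ Ψ₀ (Kerr.shellPoint M q.1 q.2.1 q.2.2.1 q.2.2.2)
      (E4.basisVector 0) :=
    ((hΨ₀1.continuous_fderiv one_ne_zero).comp (Kerr.continuous_shellPoint₄ M)).clm_apply continuous_const
  have c4TD : Continuous fun q : ℝ × ℝ × ℝ × ℝ ↦ fderiv ℝ (fderiv ℝ Ψ₀)
      (Kerr.shellPoint M q.1 q.2.1 q.2.2.1 q.2.2.2) (E4.basisVector 0)
        (E4.spaceEmbed (sphRadial q.2.2.1 q.2.2.2)) := Kerr.continuous_tauRhoDeriv_shellPoint₄ hΨ₀2 M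
  have c4DT : Continuous fun q : ℝ × ℝ × ℝ × ℝ ↦ fderiv ℝ (fun y ↦ fderiv ℝ Ψ₀ y (E4.basisVector 0))
      (Kerr.shellPoint M q.1 q.2.1 q.2.2.1 q.2.2.2) (E4.spaceEmbed (sphRadial q.2.2.1 q.2.2.2)) := by
    have hfun : (fun q : ℝ × ℝ × ℝ × ℝ ↦ fderiv ℝ (fun y ↦ fderiv ℝ Ψ₀ y (E4.basisVector 0))
        (Kerr.shellPoint M q.1 q.2.1 q.2.2.1 q.2.2.2) (E4.spaceEmbed (sphRadial q.2.2.1 q.2.2.2))) =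
        fun q ↦ fderiv ℝ (fderiv ℝ Ψ₀) (Kerr.shellPoint M q.1 q.2.1 q.2.2.1 q.2.2.2) (E4.basisVector 0)
          (E4.spaceEmbed (sphRadial q.2.2.1 q.2.2.2)) := funext fun q ↦ (hTD _ _).symm
    rw [hfun]
    exact c4TD
  have hsin3 : Continuous fun q : ℝ × ℝ × ℝ ↦ Real.sin q.2.1 :=
    Real.continuous_sin.comp (continuous_fst.comp continuous_snd)
  have hw3 : Continuous fun q : ℝ × ℝ × ℝ ↦ (q.1 - M) ^ 2 := (continuous_fst.sub continuous_const).pow 2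
  have fix3 : ∀ {F : ℝ × ℝ × ℝ × ℝ → ℝ}, Continuous F → ∀ s : ℝ,
      Continuous fun q : ℝ × ℝ × ℝ ↦ F (s, q) := fun hF s ↦
    hF.comp (Continuous.prodMk continuous_const continuous_id)
  have hs0 : ∀ θ ∈ Icc (0 : ℝ) Real.pi, 0 ≤ Real.sin θ := fun θ hθ ↦
    Real.sin_nonneg_of_nonneg_of_le_pi hθ.1 hθ.2
  /- Step 4: the six bounds for `Ψ₀` -/
  have hB₁ : ∀ τ : ℝ, τs ≤ τ → Kerr.shellIntegral M R₁ (fun r θ φ ↦ Real.sin θ *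
      (fderiv ℝ Ψ₀ (Kerr.shellPoint M τ r θ φ) (E4.spaceEmbed (sphRadial θ φ))) ^ 2) ≤ Cm := by
    intro τ hτ
    refine le_trans ?_ ((hbd τ (hτs₀.trans hτ)).trans (le_max_left _ _))
    refine Kerr.shellIntegral_le_of_subinterval le_rfl hMR₁.le (hR₁R.le.trans hRR₂)
      (hsin3.mul ((fix3 c4₁ τ).pow 2)) (hsin3.mul (((fix3 c4₀ τ).pow 2).add ((fix3 c4₁ τ).pow 2)))
      (fun r _ θ hθ φ _ ↦ mul_nonneg (hs0 θ hθ) (sq_nonneg _)) fun r _ θ hθ φ _ ↦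
        mul_le_mul_of_nonneg_left (le_add_of_nonneg_left (sq_nonneg _)) (hs0 θ hθ)
  have hB₂ : ∀ τ : ℝ, τs ≤ τ → Kerr.shellIntegral M R₁ (fun r θ φ ↦ Real.sin θ *
      (fderiv ℝ (fderiv ℝ Ψ₀) (Kerr.shellPoint M τ r θ φ) (E4.basisVector 0)
        (E4.spaceEmbed (sphRadial θ φ))) ^ 2) ≤ Cm := by
    intro τ hτ
    refine le_trans ?_ ((hbd' τ (hτs₀'.trans hτ)).trans (le_max_right _ _))
    refine Kerr.shellIntegral_le_of_subinterval le_rfl hMR₁.le (hR₁R.le.trans hRR₂')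
      (hsin3.mul ((fix3 c4TD τ).pow 2)) (hsin3.mul (((fix3 c4T τ).pow 2).add ((fix3 c4DT τ).pow 2)))
      (fun r _ θ hθ φ _ ↦ mul_nonneg (hs0 θ hθ) (sq_nonneg _)) fun r _ θ hθ φ _ ↦
        mul_le_mul_of_nonneg_left (by rw [hTD]; exact le_add_of_nonneg_left (sq_nonneg _)) (hs0 θ hθ)
  have hB₃ : ∀ τ : ℝ, τs ≤ τ → Kerr.shellIntegral R₁ R (fun r θ φ ↦ Real.sin θ *
      Ψ₀ (Kerr.shellPoint M τ r θ φ) ^ 2) ≤ Cm := by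
    intro τ hτ
    refine le_trans ?_ ((hbd τ (hτs₀.trans hτ)).trans (le_max_left _ _))
    refine Kerr.shellIntegral_le_of_subinterval hMR₁.le hR₁R.le hRR₂
      (hsin3.mul ((fix3 c4₀ τ).pow 2)) (hsin3.mul (((fix3 c4₀ τ).pow 2).add ((fix3 c4₁ τ).pow 2)))
      (fun r _ θ hθ φ _ ↦ mul_nonneg (hs0 θ hθ) (sq_nonneg _)) fun r _ θ hθ φ _ ↦
        mul_le_mul_of_nonneg_left (le_add_of_nonneg_right (sq_nonneg _)) (hs0 θ hθ)
  have hB₄ : ∀ τ : ℝ, τs ≤ τ → Kerr.shellIntegral R₁ R (fun r θ φ ↦ Real.sin θ *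
      (fderiv ℝ Ψ₀ (Kerr.shellPoint M τ r θ φ) (E4.basisVector 0)) ^ 2) ≤ Cm := by
    intro τ hτ
    refine le_trans ?_ ((hbd' τ (hτs₀'.trans hτ)).trans (le_max_right _ _))
    refine Kerr.shellIntegral_le_of_subinterval hMR₁.le hR₁R.le hRR₂'
      (hsin3.mul ((fix3 c4T τ).pow 2)) (hsin3.mul (((fix3 c4T τ).pow 2).add ((fix3 c4DT τ).pow 2)))
      (fun r _ θ hθ φ _ ↦ mul_nonneg (hs0 θ hθ) (sq_nonneg _)) fun r _ θ hθ φ _ ↦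
        mul_le_mul_of_nonneg_left (le_add_of_nonneg_right (sq_nonneg _)) (hs0 θ hθ)
  have hB₅ : ∀ τ : ℝ, τs ≤ τ → Kerr.shellIntegral R₁ R (fun r θ φ ↦ Real.sin θ *
      (fderiv ℝ Ψ₀ (Kerr.shellPoint M τ r θ φ) (E4.spaceEmbed (sphRadial θ φ))) ^ 2) ≤ Cm := by
    intro τ hτ
    refine le_trans ?_ ((hbd τ (hτs₀.trans hτ)).trans (le_max_left _ _))
    refine Kerr.shellIntegral_le_of_subinterval hMR₁.le hR₁R.le hRR₂
      (hsin3.mul ((fix3 c4₁ τ).pow 2)) (hsin3.mul (((fix3 c4₀ τ).pow 2).add ((fix3 c4₁ τ).pow 2)))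
      (fun r _ θ hθ φ _ ↦ mul_nonneg (hs0 θ hθ) (sq_nonneg _)) fun r _ θ hθ φ _ ↦
        mul_le_mul_of_nonneg_left (le_add_of_nonneg_left (sq_nonneg _)) (hs0 θ hθ)
  have hB₆ : ∀ τ : ℝ, τs ≤ τ → Kerr.shellIntegral R₁ R (fun r θ φ ↦ Real.sin θ *
      (fderiv ℝ (fderiv ℝ Ψ₀) (Kerr.shellPoint M τ r θ φ) (E4.basisVector 0)
        (E4.spaceEmbed (sphRadial θ φ))) ^ 2) ≤ Cm := by
    intro τ hτ
    refine le_trans ?_ ((hbd' τ (hτs₀'.trans hτ)).trans (le_max_right _ _))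
    refine Kerr.shellIntegral_le_of_subinterval hMR₁.le hR₁R.le hRR₂'
      (hsin3.mul ((fix3 c4TD τ).pow 2)) (hsin3.mul (((fix3 c4T τ).pow 2).add ((fix3 c4DT τ).pow 2)))
      (fun r _ θ hθ φ _ ↦ mul_nonneg (hs0 θ hθ) (sq_nonneg _)) fun r _ θ hθ φ _ ↦
        mul_le_mul_of_nonneg_left (by rw [hTD]; exact le_add_of_nonneg_left (sq_nonneg _)) (hs0 θ hθ)
  /- Step 5: the three integrability statements for `Ψ₀`, by domination -/
  set HF : ℝ → ℝ → ℝ → ℝ → ℝ := fun s r θ φ ↦ Real.sin θ *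
    (Ψ₀ (Kerr.shellPoint M s r θ φ) ^ 2 + (r - M) ^ 2 *
      (fderiv ℝ Ψ₀ (Kerr.shellPoint M s r θ φ) (E4.spaceEmbed (sphRadial θ φ))) ^ 2) with hHFdef
  set H₁ : ℝ → ℝ → ℝ → ℝ → ℝ := fun s r θ φ ↦ Real.sin θ * ((r - M) ^ 2 *
    (fderiv ℝ Ψ₀ (Kerr.shellPoint M s r θ φ) (E4.spaceEmbed (sphRadial θ φ))) ^ 2) with hH₁def
  set H₂ : ℝ → ℝ → ℝ → ℝ → ℝ := fun s r θ φ ↦ Real.sin θ * Ψ₀ (Kerr.shellPoint M s r θ φ) ^ 2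
    with hH₂def
  set H₃ : ℝ → ℝ → ℝ → ℝ → ℝ := fun s r θ φ ↦ Real.sin θ *
    (fderiv ℝ Ψ₀ (Kerr.shellPoint M s r θ φ) (E4.spaceEmbed (sphRadial θ φ))) ^ 2 with hH₃def
  have hsin4 : Continuous fun q : ℝ × ℝ × ℝ × ℝ ↦ Real.sin q.2.2.1 :=
    Real.continuous_sin.comp (continuous_fst.comp (continuous_snd.comp continuous_snd))
  have hw4 : Continuous fun q : ℝ × ℝ × ℝ × ℝ ↦ (q.2.1 - M) ^ 2 :=
    ((continuous_fst.comp continuous_snd).sub continuous_const).pow 2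
  have cF4 : Continuous fun q : ℝ × ℝ × ℝ × ℝ ↦ HF q.1 q.2.1 q.2.2.1 q.2.2.2 :=
    hsin4.mul ((c4₀.pow 2).add (hw4.mul (c4₁.pow 2)))
  have c1 : Continuous fun q : ℝ × ℝ × ℝ × ℝ ↦ H₁ q.1 q.2.1 q.2.2.1 q.2.2.2 :=
    hsin4.mul (hw4.mul (c4₁.pow 2))
  have c2 : Continuous fun q : ℝ × ℝ × ℝ × ℝ ↦ H₂ q.1 q.2.1 q.2.2.1 q.2.2.2 := hsin4.mul (c4₀.pow 2)
  have c3 : Continuous fun q : ℝ × ℝ × ℝ × ℝ ↦ H₃ q.1 q.2.1 q.2.2.1 q.2.2.2 := hsin4.mul (c4₁.pow 2)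
  have hF : IntegrableOn (fun τ ↦ Kerr.shellIntegral M R₂ (fun r θ φ ↦ HF τ r θ φ)) (Ioi τs) :=
    hiled.mono_set (Ioi_subset_Ioi hτs₀)
  have hF0 : ∀ τ, ∀ r ∈ Icc M R₂, ∀ θ ∈ Icc (0 : ℝ) Real.pi, ∀ φ ∈ Icc (0 : ℝ) (2 * Real.pi),
      0 ≤ HF τ r θ φ := fun τ r _ θ hθ φ _ ↦ mul_nonneg (hs0 θ hθ) (by positivity)
  have hI₁ : IntegrableOn (fun τ ↦ Kerr.shellIntegral M R₁ (fun r θ φ ↦ H₁ τ r θ φ)) (Ioi τs) := by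
    refine Kerr.integrableOn_Ioi_of_le hF (Kerr.continuous_shellIntegral c1) (fun τ _ ↦ ?_) fun τ _ ↦ ?_
    · exact Kerr.shellIntegral_nonneg hMR₁.le (fix3 c1 τ) fun r _ θ hθ φ _ ↦
        mul_nonneg (hs0 θ hθ) (by positivity)
    · exact Kerr.shellIntegral_le_of_subinterval le_rfl hMR₁.le (hR₁R.le.trans hRR₂) (fix3 c1 τ)
        (fix3 cF4 τ) (fun r _ θ hθ φ _ ↦ mul_nonneg (hs0 θ hθ) (by positivity)) fun r _ θ hθ φ _ ↦
          mul_le_mul_of_nonneg_left (le_add_of_nonneg_left (sq_nonneg _)) (hs0 θ hθ)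
  have hI₂ : IntegrableOn (fun τ ↦ Kerr.shellIntegral R₁ R (fun r θ φ ↦ H₂ τ r θ φ)) (Ioi τs) := by
    refine Kerr.integrableOn_Ioi_of_le hF (Kerr.continuous_shellIntegral c2) (fun τ _ ↦ ?_) fun τ _ ↦ ?_
    · exact Kerr.shellIntegral_nonneg hR₁R.le (fix3 c2 τ) fun r _ θ hθ φ _ ↦
        mul_nonneg (hs0 θ hθ) (sq_nonneg _)
    · exact Kerr.shellIntegral_le_of_subinterval hMR₁.le hR₁R.le hRR₂ (fix3 c2 τ) (fix3 cF4 τ)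
        (fun r _ θ hθ φ _ ↦ mul_nonneg (hs0 θ hθ) (sq_nonneg _)) fun r _ θ hθ φ _ ↦
          mul_le_mul_of_nonneg_left (le_add_of_nonneg_right (by positivity)) (hs0 θ hθ)
  have hI₃ : IntegrableOn (fun τ ↦ Kerr.shellIntegral R₁ R (fun r θ φ ↦ H₃ τ r θ φ)) (Ioi τs) := by
    have hF' := hF.const_mul ((R₁ - M) ^ 2)⁻¹
    refine Kerr.integrableOn_Ioi_of_le hF' (Kerr.continuous_shellIntegral c3) (fun τ _ ↦ ?_) fun τ _ ↦ ?_
    · exact Kerr.shellIntegral_nonneg hR₁R.le (fix3 c3 τ) fun r _ θ hθ φ _ ↦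
        mul_nonneg (hs0 θ hθ) (sq_nonneg _)
    · have step1 : Kerr.shellIntegral R₁ R (fun r θ φ ↦ H₃ τ r θ φ) ≤
          Kerr.shellIntegral R₁ R (fun r θ φ ↦ ((R₁ - M) ^ 2)⁻¹ * HF τ r θ φ) := by
        refine Kerr.shellIntegral_mono_on hR₁R.le (fix3 c3 τ) (continuous_const.mul (fix3 cF4 τ))
          fun r hr θ hθ φ _ ↦ ?_
        have hsθ := hs0 θ hθ
        have h1 : (R₁ - M) ^ 2 ≤ (r - M) ^ 2 :=
          pow_le_pow_left₀ hR₁M.le (by linarith [hr.1]) 2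
        simp only [hH₃def, hHFdef]
        rw [← div_eq_inv_mul, le_div_iff₀ (by positivity)]
        nlinarith [mul_le_mul_of_nonneg_left h1 (mul_nonneg hsθ
          (sq_nonneg (fderiv ℝ Ψ₀ (Kerr.shellPoint M τ r θ φ) (E4.spaceEmbed (sphRadial θ φ))))),
          mul_nonneg hsθ (sq_nonneg (Ψ₀ (Kerr.shellPoint M τ r θ φ)))]
      have step2 : Kerr.shellIntegral R₁ R (fun r θ φ ↦ HF τ r θ φ) ≤
          Kerr.shellIntegral M R₂ (fun r θ φ ↦ HF τ r θ φ) :=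
        Kerr.shellIntegral_mono_interval hMR₁.le hR₁R.le hRR₂ (fix3 cF4 τ) (hF0 τ)
      rw [Kerr.shellIntegral_const_mul] at step1
      exact step1.trans (mul_le_mul_of_nonneg_left step2 (by positivity))
  /- Step 6: `L²(S_τ)` decay of `Ψ₀`; `Ψ₀ = 2πΦ` on the horizon spheres `S_τ`, `τ ≥ 0` -/
  have hdec := Kerr.sphereL2Decay_of_shellEnergyStatements hMR₁ hR₁R hΨ₀2 hB₁ hB₂ hB₃ hB₄ hB₅ hB₆
    hI₁ hI₂ hI₃
  intro ε hε
  obtain ⟨τ₁, hτ₁⟩ := hdec ((2 * Real.pi) ^ 2 * ε) (by positivity)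
  refine ⟨max τ₁ 0, fun τ hτ ↦ ?_⟩
  have h := hτ₁ τ ((le_max_left _ _).trans hτ)
  have hτ0 : 0 ≤ τ := (le_max_right _ _).trans hτ
  have hpt : ∀ θ φ : ℝ, Real.sin θ * Φ (Kerr.horizonPoint M τ θ φ) ^ 2 =
      ((2 * Real.pi) ^ 2)⁻¹ * (Real.sin θ * Ψ₀ (Kerr.horizonPoint M τ θ φ) ^ 2) := by
    intro θ φ
    have e : Ψ₀ (Kerr.horizonPoint M τ θ φ) = 2 * Real.pi * Φ (Kerr.horizonPoint M τ θ φ) :=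
      Kerr.rotAverage_horizonPoint_eq hM hGN hKN haxi hτ0 θ φ
    rw [e, ← div_eq_inv_mul, eq_div_iff (by positivity)]
    ring
  simp only [hpt, intervalIntegral.integral_const_mul]
  calc _ ≤ ((2 * Real.pi) ^ 2)⁻¹ * ((2 * Real.pi) ^ 2 * ε) := mul_le_mul_of_nonneg_left h (by positivity)
    _ = ε := by field_simp

end Literature.Barriers.FinalStateConjecture

end
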